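import Summits.AtomisticToContinuum.Crystallization.Theorems.FreeSplittingCertificatesStrictSplittingRuleP1CellVarianceR
import Summits.AtomisticToContinuum.Crystallization.Theorems.FreeSplittingCertificatesStrictSplittingRuleP1Vertical

/-!
# `StrictSplittingRule` (stmt-AtomisticToContinuum-12560): per-cell READOUT CAPACITY — edge readouts and the vertical Bravais bond are bounded by the cell gradients' Frobenius norms (P1 interpolant object, part 34)

Route `FreeSplittingCertificates`, crux r3 `StrictSplittingRule` (H12⋆ = `stub_coreJointCoercive`), unit b2b-freesplit-B gen 24.
VALUE = the element-level inequalities of the READOUT allocation (R) of the demand side (HOME FAR-LEMMA-SPEC §17 (c)(R), §18; CERT §27 (2)–(3)):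
for lattice values `V` and a cell `T` with gradient `G_T = p1CellGrad a h V T`,
* **`p1Cell_readout_le`** — for ANY nonnegative edge coefficients `κ m m'`:
  `Σ_{m,m'} κ_{mm'}·|V(y_m) − V(y_{m'})|² ≤ (Σ_{m,m'} κ_{mm'}·|y_m − y_{m'}|²)·|G_T|²_F`
  (vertex differences are `G_Tᵀ(y_m − y_{m'})`, part 8, and `|Gᵀe|² ≤ |e|²|G|²`, part 31) — the capacity inequality `tr(GᵀS_TG) ≤ λ_T|G|²` in its Cauchy–Schwarz form, into which
  the allocation table of `code/partB/gen24-budget/cellbudget.py` is substituted edge by edge;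
* **`p1_vertical_readout_le_even/odd`** — the vertical readout bond of the first-order design:
  `|V(q+(2,0,0)) − V(q)|² ≤ 2h²·(Σ_k G_{T₁} 2 k² + Σ_k G_{T₂} 2 k²) ≤ 2h²(|G_{T₁}|² + |G_{T₂}|²)` through the tetrahedron pair of part 33.
NOT a proof of H12⋆, NOT summit progress.  [folklore]
-/

noncomputable section

open Set Function
open scoped BigOperators

namespace Summit.AtomisticToContinuum.Crystallization.Theorems.StrictSplittingRuleBirth

open Literature.MathematicalPhysics.StatisticalMechanics
open Summit.AtomisticToContinuum.Crystallization.Theorems.PalmUnimodularRigidity.LayeredLawsSelectHcp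

/-- **Edge readout of one cell ≤ (weighted edge lengths) × |G_T|²**: for nonnegative coefficients `κ` on ordered vertex pairs,
`Σ_{m,m'} κ_{mm'}·fpSq(V_m − V_{m'}) ≤ (Σ_{m,m'} κ_{mm'}·fpSq(y_m − y_{m'}))·fpFrob(G_T)`.  NOT a proof of H12⋆, NOT summit progress. -/
theorem p1Cell_readout_le {a h : ℝ} (ha : a ≠ 0) (hh : h ≠ 0) (V : ℤ × ℤ × ℤ → (Fin 3 → ℝ)) (i : (ℤ × ℤ × ℤ) × Fin 6)
    (κ : Fin 4 → Fin 4 → ℝ) (hκ : ∀ m m', 0 ≤ κ m m') :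
    ∑ m : Fin 4, ∑ m' : Fin 4, κ m m' * fpSq (fun k => p1CellVals V i m k - p1CellVals V i m' k) ≤
      (∑ m : Fin 4, ∑ m' : Fin 4, κ m m' *
          fpSq (fun k => hcpSite a h (i.1 + p1VertOff (p1Par i.1) i.2 m) k - hcpSite a h (i.1 + p1VertOff (p1Par i.1) i.2 m') k)) *
        fpFrob (p1CellGrad a h V i) := by
  rw [Finset.sum_mul]
  refine Finset.sum_le_sum fun m _ => ?_
  rw [Finset.sum_mul]
  refine Finset.sum_le_sum fun m' _ => ?_
  set e : Fin 3 → ℝ := fun k => hcpSite a h (i.1 + p1VertOff (p1Par i.1) i.2 m) k - hcpSite a h (i.1 + p1VertOff (p1Par i.1) i.2 m') k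
    with he
  have heq : (fun k => p1CellVals V i m k - p1CellVals V i m' k) =
      fun k => e 0 * p1CellGrad a h V i 0 k + e 1 * p1CellGrad a h V i 1 k + e 2 * p1CellGrad a h V i 2 k := by
    funext k
    rw [p1CellVals_sub_eq_grad ha hh V i m m' k]
  have h1 : fpSq (fun k => p1CellVals V i m k - p1CellVals V i m' k) ≤ fpSq e * fpFrob (p1CellGrad a h V i) := by
    rw [heq]
    exact fpSq_vecMul_le e (p1CellGrad a h V i)
  calc κ m m' * fpSq (fun k => p1CellVals V i m k - p1CellVals V i m' k)
      ≤ κ m m' * (fpSq e * fpFrob (p1CellGrad a h V i)) := mul_le_mul_of_nonneg_left h1 (hκ m m')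
    _ = κ m m' * fpSq e * fpFrob (p1CellGrad a h V i) := by ring

/-- The `e₃`-row energy is at most the Frobenius norm. -/
theorem row2_sq_le_fpFrob (G : Fin 3 → Fin 3 → ℝ) : G 2 0 ^ 2 + G 2 1 ^ 2 + G 2 2 ^ 2 ≤ fpFrob G := by
  unfold fpFrob; nlinarith [sq_nonneg (G 0 0), sq_nonneg (G 0 1), sq_nonneg (G 0 2), sq_nonneg (G 1 0), sq_nonneg (G 1 1), sq_nonneg (G 1 2)]

/-- **The vertical readout bond, EVEN base layer, capacity form**: `|V(q+(2,0,0)) − V(q)|² ≤ 2h²(|G_{T₁}|²_F + |G_{T₂}|²_F)` with the tetrahedra of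
`p1Field_vertical_sub_even`.  NOT a proof of H12⋆, NOT summit progress. -/
theorem p1_vertical_readout_le_even {a h : ℝ} (ha : a ≠ 0) (hh : h ≠ 0) (V : ℤ × ℤ × ℤ → (Fin 3 → ℝ)) (q : ℤ × ℤ × ℤ) (hq : Even q.1) :
    fpSq (fun k => V (q + (2, 0, 0)) k - V q k) ≤
      2 * h ^ 2 * (fpFrob (p1CellGrad a h V (q + (0, -1, -1), 1)) + fpFrob (p1CellGrad a h V (q + (1, -1, -1), 1))) := by
  have hv : ∀ k, V (q + (2, 0, 0)) k - V q k =
      h * (p1CellGrad a h V (q + (0, -1, -1), 1) 2 k + p1CellGrad a h V (q + (1, -1, -1), 1) 2 k) :=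
    fun k => p1Field_vertical_sub_even ha hh V q hq k
  simp only [fpSq, hv]
  have hcs := p1_vertical_sq_le h (p1CellGrad a h V (q + (0, -1, -1), 1)) (p1CellGrad a h V (q + (1, -1, -1), 1))
  have h1 := row2_sq_le_fpFrob (p1CellGrad a h V (q + (0, -1, -1), 1))
  have h2 := row2_sq_le_fpFrob (p1CellGrad a h V (q + (1, -1, -1), 1))
  nlinarith [sq_nonneg h]

/-- **The vertical readout bond, ODD base layer, capacity form**: `|V(q+(2,0,0)) − V(q)|² ≤ 2h²(|G_{T₁}|²_F + |G_{T₂}|²_F)` with the tetrahedra of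
`p1Field_vertical_sub_odd`.  NOT a proof of H12⋆, NOT summit progress. -/
theorem p1_vertical_readout_le_odd {a h : ℝ} (ha : a ≠ 0) (hh : h ≠ 0) (V : ℤ × ℤ × ℤ → (Fin 3 → ℝ)) (q : ℤ × ℤ × ℤ) (hq : Odd q.1) :
    fpSq (fun k => V (q + (2, 0, 0)) k - V q k) ≤
      2 * h ^ 2 * (fpFrob (p1CellGrad a h V (q, 0)) + fpFrob (p1CellGrad a h V (q + (1, 0, 0), 0))) := by
  have hv : ∀ k, V (q + (2, 0, 0)) k - V q k = h * (p1CellGrad a h V (q, 0) 2 k + p1CellGrad a h V (q + (1, 0, 0), 0) 2 k) :=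
    fun k => p1Field_vertical_sub_odd ha hh V q hq k
  simp only [fpSq, hv]
  have hcs := p1_vertical_sq_le h (p1CellGrad a h V (q, 0)) (p1CellGrad a h V (q + (1, 0, 0), 0))
  have h1 := row2_sq_le_fpFrob (p1CellGrad a h V (q, 0))
  have h2 := row2_sq_le_fpFrob (p1CellGrad a h V (q + (1, 0, 0), 0))
  nlinarith [sq_nonneg h]

end Summit.AtomisticToContinuum.Crystallization.Theorems.StrictSplittingRuleBirth
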